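import Literature.NumberTheory.EllipticCurves.Serre1967.NoStableDivisibleLineOfContractionProofs
import Literature.NumberTheory.EllipticCurves.Serre1967.SupersingularPlaceDivisionPolynomialShapeProofs
import Literature.NumberTheory.EllipticCurves.SpectralValuationDegreeLowerBoundProofs
import Literature.NumberTheory.EllipticCurves.VariableChangePointsMap
import HarnessLib

/-!
# Serre 1967, §5 Prop. 8 (torsion form) over the completion of a number field at a place of good
# SUPERSINGULAR reduction: `E(K̄_v)[p^∞]` has no `Γ_{K_v}`-stable `p`-divisible line (proofs only)

`Proofs`-style file (THEOREMS ONLY), topic `NumberTheory/EllipticCurves`, paper group `Serre1967`.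
For `E/K` (`K` a number field), a finite place `v ∋ p` with `E.HasGoodReductionAt v` and
`¬ E.HasUnitRootAt v`: every `Γ_{K_v}`-stable subgroup `N ≤ E(K̄_v)` consisting of `p`-power torsion,
`p`-divisible inside itself, whose `p`-torsion is finite with at most `p` elements, is trivial
(`Serre1967.eq_bot_of_stable_localPoints`). This is the instance `L = K̄_v`, `D = Γ_{K_v}` of the
abstract assembly `Serre1967.eq_bot_of_stable_divisible_of_contraction`: the supersingular shape of
the division polynomials of `V = (E.localMinimalModel v) ⊗ K̄_v`
(`exists_shape_ΨSq_localMinimalModel_baseChange`), the degree/valuation bound over `K_v`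
(`exists_pos_forall_div_index_le_log_spectralValuation`, with `H` the stabiliser of the point: its
index is the size of the orbit), and the `Γ_{K_v}`-equivariant transport `E(K̄_v) ≃ V(K̄_v)` along the
change of variables over `K_v` to the local minimal model (`VariableChange.pointEquivBaseChange`).

* `Serre1967.eq_bot_of_stable_of_addEquiv` — transport of the statement along an equivariant
  additive isomorphism (pure algebra);
* `Serre1967.eq_bot_of_stable_localPoints_localMinimalModel` — the statement for
  `V = (E.localMinimalModel v) ⊗ K̄_v`;
* `Serre1967.eq_bot_of_stable_localPoints` — the statement for `E ⊗ K̄_v` (`localPoints E K_v`).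

## References

* J.-P. Serre, Proc. Conf. Local Fields (Driebergen 1966), Springer 1967, §5 Prop. 8 / Lemme 3.
  [Serre1967GroupesPDivisibles]
* J. H. Silverman, *The Arithmetic of Elliptic Curves*, 2nd ed. (2009), VII.1–VII.3. [SilvermanAEC2009]
-/

noncomputable section

open scoped Classical NNReal

universe u

namespace Literature.NumberTheory.EllipticCurves.Serre1967

open WeierstrassCurve Field NumberField IsDedekindDomain

/-! ### Transport along an equivariant additive isomorphism -/

section Transport

variable {G G' : Type*} [AddCommGroup G] [AddCommGroup G'] {D : Type*} [Monoid D]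
  [DistribMulAction D G] [DistribMulAction D G'] (p : ℕ)

/-- Transport of «no stable `p`-divisible line» along a `D`-equivariant additive isomorphism
`e : G ≃+ G'`: if every `D`-stable, `p`-primary, `p`-divisible subgroup of `G'` with finite `p`-torsion
of size `≤ p` is trivial, the same holds in `G` (the formulation-invariance used to pass between
isomorphic models, Serre §5: «Quitte à transformer z par une homothétie…»).
[cite: Serre1967GroupesPDivisibles, §5 Prop. 8 (proof)] -/
theorem eq_bot_of_stable_of_addEquiv (e : G ≃+ G') (he : ∀ (d : D) (x : G), e (d • x) = d • e x)
    (hG' : ∀ N' : AddSubgroup G', (∀ d : D, ∀ c ∈ N', d • c ∈ N') →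
      (∀ c ∈ N', ∃ k : ℕ, p ^ k • c = 0) → (∀ c ∈ N', ∃ c' ∈ N', p • c' = c) →
      {c : G' | c ∈ N' ∧ p • c = 0}.Finite → Set.ncard {c : G' | c ∈ N' ∧ p • c = 0} ≤ p → N' = ⊥)
    (N : AddSubgroup G) (hstab : ∀ d : D, ∀ c ∈ N, d • c ∈ N)
    (htors : ∀ c ∈ N, ∃ k : ℕ, p ^ k • c = 0) (hdiv : ∀ c ∈ N, ∃ c' ∈ N, p • c' = c)
    (hfin : {c : G | c ∈ N ∧ p • c = 0}.Finite) (hcard : Set.ncard {c : G | c ∈ N ∧ p • c = 0} ≤ p) :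
    N = ⊥ := by
  set N' : AddSubgroup G' := N.map e.toAddMonoidHom with hN'
  have hmem : ∀ {c' : G'}, c' ∈ N' ↔ ∃ c ∈ N, e c = c' := fun {c'} => by
    rw [hN', AddSubgroup.mem_map]; rfl
  have hset : {c : G' | c ∈ N' ∧ p • c = 0} = e '' {c : G | c ∈ N ∧ p • c = 0} := by
    ext c'
    constructor
    · rintro ⟨hc', hp0⟩
      obtain ⟨c, hc, rfl⟩ := hmem.mp hc'
      refine ⟨c, ⟨hc, e.injective ?_⟩, rfl⟩
      rw [map_nsmul, map_zero]; exact hp0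
    · rintro ⟨c, ⟨hc, hp0⟩, rfl⟩
      exact ⟨hmem.mpr ⟨c, hc, rfl⟩, by rw [← map_nsmul, hp0, map_zero]⟩
  have hN'bot : N' = ⊥ := by
    refine hG' N' ?_ ?_ ?_ ?_ ?_
    · intro d c' hc'
      obtain ⟨c, hc, rfl⟩ := hmem.mp hc'
      rw [← he]; exact hmem.mpr ⟨d • c, hstab d c hc, rfl⟩
    · intro c' hc'
      obtain ⟨c, hc, rfl⟩ := hmem.mp hc'
      obtain ⟨k, hk⟩ := htors c hc
      exact ⟨k, by rw [← map_nsmul, hk, map_zero]⟩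
    · intro c' hc'
      obtain ⟨c, hc, rfl⟩ := hmem.mp hc'
      obtain ⟨c₁, hc₁, hpc₁⟩ := hdiv c hc
      exact ⟨e c₁, hmem.mpr ⟨c₁, hc₁, rfl⟩, by rw [← map_nsmul, hpc₁]⟩
    · rw [hset]; exact hfin.image _
    · rw [hset, Set.ncard_image_of_injective _ e.injective]; exact hcard
  rw [eq_bot_iff]
  intro c hc
  have : e c ∈ N' := hmem.mpr ⟨c, hc, rfl⟩
  rw [hN'bot, AddSubgroup.mem_bot] at this
  rw [AddSubgroup.mem_bot]
  exact e.injective (by rw [this, map_zero])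

end Transport

/-! ### Over `K̄_v`: the local minimal model -/

section Local

variable {K : Type u} [Field K] [NumberField K] (E : WeierstrassCurve K) (v : HeightOneSpectrum (𝓞 K))
  {p : ℕ} [hp : Fact p.Prime]

/-- **No `Γ_{K_v}`-stable `p`-divisible line on `V(K̄_v)`, `V` the local minimal model at a place of
good supersingular reduction** (Serre 1967 §5 Prop. 8, torsion form): the instance `L = K̄_v`,
`W = V ⊗ K̄_v`, `D = Γ_{K_v}` of `eq_bot_of_stable_divisible_of_contraction`.
[cite: Serre1967GroupesPDivisibles, §5 Prop. 8] -/
theorem eq_bot_of_stable_localPoints_localMinimalModel (hv : (p : 𝓞 K) ∈ v.asIdeal)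
    (hgood : E.HasGoodReductionAt v) (hss : ¬ E.HasUnitRootAt v)
    (N : AddSubgroup (localPoints (E.localMinimalModel v) (v.adicCompletion K)))
    (hstab : ∀ σ : absoluteGaloisGroup (v.adicCompletion K), ∀ c ∈ N, σ • c ∈ N)
    (htors : ∀ c ∈ N, ∃ k : ℕ, p ^ k • c = 0) (hdiv : ∀ c ∈ N, ∃ c' ∈ N, p • c' = c)
    (hfin : {c | c ∈ N ∧ p • c = 0}.Finite) (hcard : Set.ncard {c | c ∈ N ∧ p • c = 0} ≤ p) :
    N = ⊥ := by
  obtain ⟨w, hw⟩ := v.exists_spectralValuation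
  obtain ⟨μ, hμ1, hΦ, hΨ0, hΨ⟩ := E.exists_shape_ΨSq_localMinimalModel_baseChange v hw hv hgood hss
  obtain ⟨b, hb, hlow⟩ :=
    IsDedekindDomain.HeightOneSpectrum.exists_pos_forall_div_index_le_log_spectralValuation hw
  refine @eq_bot_of_stable_divisible_of_contraction _ _ w
    ((E.localMinimalModel v).baseChange (AlgebraicClosure (v.adicCompletion K))) p _
    (absoluteGaloisGroup (v.adicCompletion K)) _
    (localPoints.instDistribMulActionAbsoluteGaloisGroup (E.localMinimalModel v) (v.adicCompletion K))
    μ hμ1 hΦ hΨ0 hΨ b hb ?_ N hstab htors hdiv hfin hcard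
  intro x y h hx m hm hfinorb horb
  -- the point, in the `Γ_{K_v}`-module `V(K̄_v)`
  set P : localPoints (E.localMinimalModel v) (v.adicCompletion K) :=
    WeierstrassCurve.Affine.Point.some x y h with hP
  have hfinorb' : (Set.range fun d : absoluteGaloisGroup (v.adicCompletion K) => d • P).Finite := hfinorb
  have horb' : (Set.range fun d : absoluteGaloisGroup (v.adicCompletion K) => d • P).ncard ≤ m := horb
  -- the stabiliser of the point has index = size of the orbit `≤ m`, and fixes `x`
  set H : Subgroup (AlgebraicClosure (v.adicCompletion K) ≃ₐ[v.adicCompletion K]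
      AlgebraicClosure (v.adicCompletion K)) :=
    MulAction.stabilizer (absoluteGaloisGroup (v.adicCompletion K)) P with hH
  have hindex : H.index = (Set.range fun d : absoluteGaloisGroup (v.adicCompletion K) => d • P).ncard :=
    MulAction.index_stabilizer (absoluteGaloisGroup (v.adicCompletion K)) P
  have hH0 : H.index ≠ 0 := by
    rw [hindex]
    exact ((Set.ncard_pos hfinorb').mpr ⟨P, 1, one_smul _ _⟩).ne'
  have hHle : H.index ≤ m := hindex ▸ horb'
  have hfix : ∀ σ ∈ H, σ x = x := by
    intro σ hσ
    have hσP : (show absoluteGaloisGroup (v.adicCompletion K) from σ) • P = P :=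
      MulAction.mem_stabilizer_iff.mp hσ
    rw [hP, localPoints.smul_def, WeierstrassCurve.Affine.Point.map_some] at hσP
    exact (WeierstrassCurve.Affine.Point.some.injEq _ _ _ _ _ _ |>.mp hσP).1
  have h1 := hlow x hx H hH0 hfix
  have hm0 : (0 : ℝ) < m := by exact_mod_cast hm
  have hidx0 : (0 : ℝ) < H.index := by exact_mod_cast Nat.pos_of_ne_zero hH0
  calc b / m ≤ b / H.index := by
        apply div_le_div_of_nonneg_left hb.le hidx0
        exact_mod_cast hHle
    _ ≤ Real.log (w x) := h1

/-! ### Over `K̄_v`: the curve itself -/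

/-- The `Γ_{K_v}`-equivariant isomorphism `E(K̄_v) ≃+ V(K̄_v)` onto the points of the local minimal
model (`V = C • E_{K_v}`, `C` over `K_v`; Silverman AEC VII.1). Private plumbing. [folklore] -/
private theorem exists_addEquiv_localPoints_localMinimalModel :
    ∃ e : localPoints E (v.adicCompletion K) ≃+ localPoints (E.localMinimalModel v) (v.adicCompletion K),
      ∀ (σ : absoluteGaloisGroup (v.adicCompletion K)) (P : localPoints E (v.adicCompletion K)),
        e (σ • P) = σ • e P := by
  set C : WeierstrassCurve.VariableChange (v.adicCompletion K) :=
    ((E.baseChange (v.adicCompletion K)).exists_isMinimal (v.adicCompletionIntegers K)).choose with hC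
  have hmin : E.localMinimalModel v = C • E.baseChange (v.adicCompletion K) := rfl
  have h₁ : E.baseChange (AlgebraicClosure (v.adicCompletion K)) =
      (E.baseChange (v.adicCompletion K)).baseChange (AlgebraicClosure (v.adicCompletion K)) := by
    rw [WeierstrassCurve.baseChange, WeierstrassCurve.baseChange, WeierstrassCurve.baseChange,
      WeierstrassCurve.map_map, ← IsScalarTower.algebraMap_eq]
  have h₃ : (C • E.baseChange (v.adicCompletion K)).baseChange (AlgebraicClosure (v.adicCompletion K)) =
      (E.localMinimalModel v).baseChange (AlgebraicClosure (v.adicCompletion K)) := by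
    rw [hmin]
  let e₁ : localPoints E (v.adicCompletion K) ≃+
      ((E.baseChange (v.adicCompletion K)).baseChange (AlgebraicClosure (v.adicCompletion K))).toAffine.Point :=
    WeierstrassCurve.Affine.Point.congrEquiv h₁
  let e₂ := WeierstrassCurve.VariableChange.pointEquivBaseChange (E.baseChange (v.adicCompletion K)) C
    (AlgebraicClosure (v.adicCompletion K))
  let e₃ : ((C • E.baseChange (v.adicCompletion K)).baseChange
      (AlgebraicClosure (v.adicCompletion K))).toAffine.Point ≃+
      localPoints (E.localMinimalModel v) (v.adicCompletion K) :=
    WeierstrassCurve.Affine.Point.congrEquiv h₃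
  refine ⟨e₁.trans (e₂.trans e₃), fun σ P => ?_⟩
  -- equivariance, on coordinates
  change (E.baseChange (AlgebraicClosure (v.adicCompletion K))).toAffine.Point at P
  rcases P with _ | ⟨x, y, hxy⟩
  · have h0 : (σ • (0 : localPoints E (v.adicCompletion K))) = 0 := smul_zero σ
    rw [show (WeierstrassCurve.Affine.Point.zero :
        (E.baseChange (AlgebraicClosure (v.adicCompletion K))).toAffine.Point) =
      (0 : localPoints E (v.adicCompletion K)) from rfl, h0, map_zero, smul_zero]
  · rw [show (σ • (show localPoints E (v.adicCompletion K) from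
        WeierstrassCurve.Affine.Point.some x y hxy)) = _ from localPoints.smul_def _ _ σ _,
      WeierstrassCurve.Affine.Point.map_some]
    simp only [AddEquiv.trans_apply]
    erw [WeierstrassCurve.Affine.Point.congrEquiv_some h₁,
      WeierstrassCurve.Affine.Point.congrEquiv_some h₁,
      WeierstrassCurve.VariableChange.pointEquivBaseChange_some,
      WeierstrassCurve.VariableChange.pointEquivBaseChange_some]
    erw [localPoints.smul_def, WeierstrassCurve.Affine.Point.map_some]
    congr 1
    · exact (WeierstrassCurve.VariableChange.map_toX C
        ((AlgEquiv.restrictScalars (v.adicCompletion K)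
          (show AlgebraicClosure (v.adicCompletion K) ≃ₐ[v.adicCompletion K]
            AlgebraicClosure (v.adicCompletion K) from σ) :
          AlgebraicClosure (v.adicCompletion K) ≃ₐ[v.adicCompletion K]
            AlgebraicClosure (v.adicCompletion K)) :
          AlgebraicClosure (v.adicCompletion K) →ₐ[v.adicCompletion K]
            AlgebraicClosure (v.adicCompletion K)) x).symm
    · exact (WeierstrassCurve.VariableChange.map_toY C
        ((AlgEquiv.restrictScalars (v.adicCompletion K)
          (show AlgebraicClosure (v.adicCompletion K) ≃ₐ[v.adicCompletion K]
            AlgebraicClosure (v.adicCompletion K) from σ) :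
          AlgebraicClosure (v.adicCompletion K) ≃ₐ[v.adicCompletion K]
            AlgebraicClosure (v.adicCompletion K)) :
          AlgebraicClosure (v.adicCompletion K) →ₐ[v.adicCompletion K]
            AlgebraicClosure (v.adicCompletion K)) x y).symm

/-- **Serre 1967, §5 Prop. 8 (torsion form) at a place of good SUPERSINGULAR reduction of a number
field**: for `E/K`, `v ∋ p` with `E.HasGoodReductionAt v` and `¬ E.HasUnitRootAt v`, every
`Γ_{K_v}`-stable subgroup `N ≤ E(K̄_v)` of `p`-power torsion points, `p`-divisible inside itself and
with finite `p`-torsion of size `≤ p`, is trivial — `T_pE` has no `ℤ_p`-line stable under `Γ_{K_v}`.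
[cite: Serre1967GroupesPDivisibles, §5 Prop. 8] -/
theorem eq_bot_of_stable_localPoints (hv : (p : 𝓞 K) ∈ v.asIdeal)
    (hgood : E.HasGoodReductionAt v) (hss : ¬ E.HasUnitRootAt v)
    (N : AddSubgroup (localPoints E (v.adicCompletion K)))
    (hstab : ∀ σ : absoluteGaloisGroup (v.adicCompletion K), ∀ c ∈ N, σ • c ∈ N)
    (htors : ∀ c ∈ N, ∃ k : ℕ, p ^ k • c = 0) (hdiv : ∀ c ∈ N, ∃ c' ∈ N, p • c' = c)
    (hfin : {c | c ∈ N ∧ p • c = 0}.Finite) (hcard : Set.ncard {c | c ∈ N ∧ p • c = 0} ≤ p) :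
    N = ⊥ := by
  obtain ⟨e, he⟩ := exists_addEquiv_localPoints_localMinimalModel E v
  exact eq_bot_of_stable_of_addEquiv p e he
    (fun N' h1 h2 h3 h4 h5 =>
      eq_bot_of_stable_localPoints_localMinimalModel E v hv hgood hss N' h1 h2 h3 h4 h5)
    N hstab htors hdiv hfin hcard

end Local

end Literature.NumberTheory.EllipticCurves.Serre1967

end
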